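import Mathlib
import Summits.AtomisticToContinuum.BoseEinsteinCondensation.Theses.BECSubharmonicContinuation
import Summits.AtomisticToContinuum.BoseEinsteinCondensation.Theorems.BECSubharmonicContinuationBallCriterionMultiplier
import Summits.AtomisticToContinuum.BoseEinsteinCondensation.Theorems.BECSubharmonicContinuationBallCriterionFourier
import HarnessLib

/-!
# `BallCriterion` (item stmt-AtomisticToContinuum-9002, route BECSubharmonicContinuation)

For `L > 0` and a periodic trial state `Ψ` of `N` bosons on the torus of side `L`: if the mean over
the ball `B(0, L/2)` of the translation coherence
`G(y) = Re ∫_{cell^N} conj Ψ(X with xᵢ ↦ xᵢ + y) Ψ(X) dX` is at least `σ`, then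
`condensateOccupation ≥ (2σ - 1) N`.

Proof: by the momentum representation (`setIntegral_conj_translate_mul_eq_tsum`)
`G(y) = N⁻¹ ∑_p n_p Re e_p(y)` with `n_p ≥ 0`, `∑_p n_p = N`, `n_0 = condensateOccupation`; averaging
over the ball termwise (`integral_tsum`) gives `⨍_B G = N⁻¹ ∑_p n_p Re ⨍_B e_p`, and the ball
multiplier satisfies `⨍_B e_0 = 1`, `Re ⨍_B e_p ≤ 1/2` for `p ≠ 0`
(`re_setAverage_ball_cellWave_le`), whence `⨍_B G ≤ 1/2 + n_0/(2N)`.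
-/

noncomputable section

open MeasureTheory Filter Set WithLp Complex Metric
open scoped ENNReal NNReal ComplexConjugate

namespace Summit.AtomisticToContinuum.BoseEinsteinCondensation.Theorems

open Literature.MathematicalPhysics.QuantumManyBody.BoseGas

section Average

variable {n : ℕ} {L : ℝ}

/-- The plane-wave occupations of a periodic trial state are finite. [folklore] -/
theorem cellOccupation_planeWaveMode_ne_top (hL : 0 < L) (Ψ : PeriodicTrialState (n + 1) L)
    (p : Fin 3 → ℤ) : cellOccupation (n + 1) L (planeWaveMode L p) Ψ.ψ ≠ ⊤ :=
  ne_top_of_le_ne_top (ENNReal.natCast_ne_top (n + 1)) (Ψ.cellOccupation_planeWaveMode_le hL p)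

/-- **`tr γ = N` in real form**: the real plane-wave occupations `n_p/(n+1)` sum to `1`. [folklore] -/
theorem hasSum_toReal_cellOccupation_planeWaveMode_div (hL : 0 < L)
    (Ψ : PeriodicTrialState (n + 1) L) :
    HasSum (fun p : Fin 3 → ℤ =>
      (cellOccupation (n + 1) L (planeWaveMode L p) Ψ.ψ).toReal / (n + 1)) 1 := by
  have hne := cellOccupation_planeWaveMode_ne_top hL Ψ
  have hsum := Ψ.tsum_cellOccupation_planeWaveMode hL
  have hs : Summable fun p : Fin 3 → ℤ =>
      (cellOccupation (n + 1) L (planeWaveMode L p) Ψ.ψ).toReal :=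
    ENNReal.summable_toReal (by rw [hsum]; exact ENNReal.natCast_ne_top (n + 1))
  have h := hs.hasSum
  rw [← ENNReal.tsum_toReal_eq hne, hsum, ENNReal.toReal_natCast] at h
  have h2 := h.div_const ((n : ℝ) + 1)
  have hN : (0 : ℝ) < (n : ℝ) + 1 := by positivity
  rwa [show (((n + 1 : ℕ) : ℝ)) / ((n : ℝ) + 1) = 1 by push_cast; exact div_self hN.ne'] at h2

/-- **The ball average of the translation coherence is at most `1/2 + n₀/(2N)`**: for a periodic
trial state `Ψ` of `n+1` bosons on the torus of side `L > 0` and every particle `i`,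
`⨍_{B(0,L/2)} Re ∫_{cell^{n+1}} conj Ψ(X with xᵢ ↦ xᵢ + y) Ψ(X) dX dy ≤ 1/2 + ⟨Ψ,n₀Ψ⟩/(2(n+1))`
(momentum representation, termwise ball average, ball multiplier `≤ 1/2` off the zero mode).
[cite: LSSY2005, §1.2 (1.17)–(1.18)] -/
theorem setAverage_ball_re_pairing_le (hL : 0 < L) (Ψ : PeriodicTrialState (n + 1) L)
    (i : Fin (n + 1)) :
    ⨍ y in ball (0 : Space) (L / 2),
        (∫ X in cellN (n + 1) L, conj (Ψ.ψ (Function.update X i (X i + y))) * Ψ.ψ X).re ≤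
      1 / 2 + (condensateOccupation (n + 1) L Ψ.ψ).toReal / (2 * (n + 1)) := by
  classical
  -- the real occupations `c_p = n_p/(n+1)`
  set c : (Fin 3 → ℤ) → ℝ := fun p =>
    (cellOccupation (n + 1) L (planeWaveMode L p) Ψ.ψ).toReal / (n + 1) with hc
  have hc0 : ∀ p, 0 ≤ c p := fun p => by rw [hc]; positivity
  have hcsum : HasSum c 1 := hasSum_toReal_cellOccupation_planeWaveMode_div hL Ψ
  have hczero : c 0 = (condensateOccupation (n + 1) L Ψ.ψ).toReal / (n + 1) := by
    rw [hc]
    simp only [cellOccupation_planeWaveMode_zero]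
  -- the terms of the momentum representation
  set g : (Fin 3 → ℤ) → Space → ℂ := fun p y => (c p : ℂ) * conj (cellWave L p y) with hg
  have hrep : ∀ y : Space,
      ∫ X in cellN (n + 1) L, conj (Ψ.ψ (Function.update X i (X i + y))) * Ψ.ψ X =
        ∑' p, g p y := fun y => setIntegral_conj_translate_mul_eq_tsum hL Ψ i y
  have hgn : ∀ p y, ‖g p y‖ = c p := by
    intro p y
    rw [hg]
    simp only [norm_mul, Complex.norm_real, Real.norm_of_nonneg (hc0 p), Complex.norm_conj,
      norm_cellWave, mul_one]
  have hgc : ∀ p, Continuous (g p) := by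
    intro p
    rw [hg]
    exact continuous_const.mul (Complex.continuous_conj.comp (contDiff_cellWave L p).continuous)
  -- the ball
  set B : Set Space := ball (0 : Space) (L / 2) with hB
  have hBvol : volume B < ⊤ := measure_ball_lt_top
  -- (1) `∫_B Re S = Re ∫_B S` for the continuous bounded sum `S = ∑' g p`
  have hSc : Continuous fun y => ∑' p, g p y :=
    continuous_tsum hgc hcsum.summable fun p y => (hgn p y).le
  have hSint : IntegrableOn (fun y => ∑' p, g p y) B volume := by
    refine Measure.integrableOn_of_bounded (M := 1) hBvol.ne hSc.aestronglyMeasurable ?_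
    refine Eventually.of_forall fun y => ?_
    have h1 : Summable fun p => ‖g p y‖ := by simp only [hgn]; exact hcsum.summable
    calc ‖∑' p, g p y‖ ≤ ∑' p, ‖g p y‖ := norm_tsum_le_tsum_norm h1
      _ = 1 := by simp only [hgn]; exact hcsum.tsum_eq
  have h1 : ∫ y in B, (∑' p, g p y).re = (∫ y in B, ∑' p, g p y).re := by
    have := integral_re hSint
    simpa using this
  -- (2) `∫_B S = ∑' ∫_B g p`
  have h2 : ∫ y in B, ∑' p, g p y = ∑' p, ∫ y in B, g p y := by
    refine integral_tsum (fun p => (hgc p).aestronglyMeasurable) ?_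
    have hterm : ∀ p, ∫⁻ y in B, ‖g p y‖ₑ = ENNReal.ofReal (c p) * volume B := by
      intro p
      have : (fun y => ‖g p y‖ₑ) = fun _ => ENNReal.ofReal (c p) := by
        funext y; rw [← ofReal_norm, hgn]
      rw [this, setLIntegral_const]
    simp only [hterm]
    rw [ENNReal.tsum_mul_right, ← ENNReal.ofReal_tsum_of_nonneg hc0 hcsum.summable, hcsum.tsum_eq]
    exact ENNReal.mul_ne_top ENNReal.ofReal_ne_top hBvol.ne
  -- (3) each term: `∫_B g p = c p conj(∫_B e_p)`
  have h3 : ∀ p, ∫ y in B, g p y = (c p : ℂ) * conj (∫ y in B, cellWave L p y) := by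
    intro p
    rw [hg]
    simp only
    rw [integral_const_mul, integral_conj]
  -- (4) summability of the averaged terms and the `HasSum` for the ball average
  have hsB : Summable fun p => ∫ y in B, g p y := by
    refine Summable.of_norm_bounded (hcsum.summable.mul_right (volume.real B)) fun p => ?_
    exact norm_setIntegral_le_of_norm_le_const hBvol fun y _ => (hgn p y).le
  have hHS : HasSum (fun p => ∫ y in B, g p y) (∫ y in B, ∑' p, g p y) := by
    rw [h2]; exact hsB.hasSum
  have hHS2 : HasSum (fun p => ((volume.real B)⁻¹ • ∫ y in B, g p y).re)
      (((volume.real B)⁻¹ • ∫ y in B, ∑' p, g p y).re) :=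
    Complex.hasSum_re (hHS.const_smul ((volume.real B)⁻¹))
  have hLHS : ⨍ y in B, (∫ X in cellN (n + 1) L,
      conj (Ψ.ψ (Function.update X i (X i + y))) * Ψ.ψ X).re =
      ((volume.real B)⁻¹ • ∫ y in B, ∑' p, g p y).re := by
    simp only [hrep]
    rw [setAverage_eq, h1, Complex.smul_re, smul_eq_mul]
  have hterm : ∀ p, ((volume.real B)⁻¹ • ∫ y in B, g p y).re =
      c p * (⨍ y in B, cellWave L p y).re := by
    intro p
    rw [h3, setAverage_eq, Complex.smul_re, Complex.smul_re, smul_eq_mul, smul_eq_mul,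
      Complex.re_ofReal_mul, Complex.conj_re]
    ring
  simp only [hterm] at hHS2
  -- (5) the comparison series
  have hbound : ∀ p, c p * (⨍ y in B, cellWave L p y).re ≤ c p / 2 + if p = 0 then c 0 / 2 else 0 := by
    intro p
    by_cases hp : p = 0
    · subst hp
      rw [if_pos rfl, hB, setAverage_ball_cellWave_zero hL, Complex.one_re]
      linarith
    · rw [if_neg hp, add_zero]
      have := re_setAverage_ball_cellWave_le hL hp
      have := mul_le_mul_of_nonneg_left this (hc0 p)
      linarith
  have hRHS : HasSum (fun p => c p / 2 + if p = 0 then c 0 / 2 else 0) (1 / 2 + c 0 / 2) :=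
    (hcsum.div_const 2).add (hasSum_ite_eq (0 : Fin 3 → ℤ) (c 0 / 2))
  have hle := hasSum_le hbound hHS2 hRHS
  rw [hLHS]
  calc ((volume.real B)⁻¹ • ∫ y in B, ∑' p, g p y).re ≤ 1 / 2 + c 0 / 2 := hle
    _ = 1 / 2 + (condensateOccupation (n + 1) L Ψ.ψ).toReal / (2 * (n + 1)) := by
        have hN : (n : ℝ) + 1 ≠ 0 := by positivity
        rw [hczero]
        field_simp

end Average

/-- **`BallCriterion`** (item stmt-AtomisticToContinuum-9002, support of route
BECSubharmonicContinuation): for `L > 0` and any periodic trial state `Ψ` of `N` bosons, if the mean of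
the translation coherence `G_Ψ(i, ·)` over the ball `B(0, L/2)` is at least `σ`, then
`condensateOccupation N L Ψ ≥ (2σ - 1) N`. Proof: `⨍_B G ≤ 1/2 + n₀/(2N)`
(`setAverage_ball_re_pairing_le`: momentum representation and the ball multiplier bound
`Re ⨍_B e_p ≤ 1/2` for `p ≠ 0`). [cite: LSSY2005, §1.2 (1.17)–(1.18)] -/
theorem ballCriterion_proof : Theses.BECSubharmonicContinuation.BallCriterion := by
  unfold Theses.BECSubharmonicContinuation.BallCriterion
  intro G N L σ hL Ψ i hσ
  cases N with
  | zero => exact i.elim0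
  | succ n =>
    have hav := setAverage_ball_re_pairing_le hL Ψ i
    have hσ' : σ ≤ 1 / 2 + (condensateOccupation (n + 1) L Ψ.ψ).toReal / (2 * (n + 1)) :=
      hσ.trans hav
    refine ENNReal.ofReal_le_of_le_toReal ?_
    have hN : (0 : ℝ) < (n : ℝ) + 1 := by positivity
    have h2 : (2 * σ - 1) * ((n : ℝ) + 1) ≤ (condensateOccupation (n + 1) L Ψ.ψ).toReal := by
      have := mul_le_mul_of_nonneg_right hσ' (by positivity : (0 : ℝ) ≤ 2 * ((n : ℝ) + 1))
      field_simp at this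
      nlinarith [this]
    push_cast
    exact h2

end Summit.AtomisticToContinuum.BoseEinsteinCondensation.Theorems

end
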